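import Literature.MathematicalPhysics.QuantumManyBody.PeriodicFeynmanKacPerronFrobenius
import Literature.MathematicalPhysics.QuantumManyBody.PeriodicFeynmanKacTrialState
import Literature.MathematicalPhysics.QuantumManyBody.GroundStateFeynmanKacProofs
import HarnessLib

/-!
# Route `BECConjugateDomination`, support item `PositiveMinimiser` — the Feynman–Kac ground state on
# the torus, I: the witness `φ₀ = μ₀⁻¹ e^{-H} e⁺` and its properties

Step of item stmt-AtomisticToContinuum-11787 (torus twin of the tree's Dirichlet files
`GroundStateFeynmanKacWitness(Symm).lean`). For a measurable pair potential with bounded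
periodisation `v^per ≤ C` and `L > 0`, let `e ≥ 0` be the Perron–Frobenius unit eigenvector of the
compact positivity-improving operator `T_1 = pfkL2 v L 1 = e^{-H}` on `L²([0,L)^{3N})`
(`pfkL2_perronFrobenius`), `μ₀ = ‖T_1‖`. With the PERIODIC positive representative
`e⁺ = max(e ∘ cellProj L, 0)` and `φ₀ = μ₀⁻¹ · pfkReal v L 1 e⁺` (a function defined everywhere
on `(ℝ³)^N` through the path integral) we prove: `φ₀` is measurable, nonnegative, periodic,
continuous, equal to `e` a.e. on the cell, strictly positive EVERYWHERE, Bose symmetric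
(simplicity of `μ₀`), and satisfies the pointwise eigen-relation `e^{-TH}φ₀ = μ₀ᵀ φ₀` for every
`T > 0`. [folklore] (Reed–Simon IV Thm XIII.44; Chung–Zhao Thm 3.17 on the torus.)
-/

noncomputable section

namespace Summit.AtomisticToContinuum.BoseEinsteinCondensation.Theorems.PositiveMinimiser

open MeasureTheory ProbabilityTheory Filter Set
open scoped ENNReal NNReal Topology InnerProductSpace
open Literature.MathematicalPhysics.QuantumManyBody.BoseGas

variable {N : ℕ} {v : ℝ → ℝ≥0∞} {L : ℝ} {C : ℝ≥0}

/-! ### Relabelling the particles on the cell -/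

/-- The cell is invariant under relabelling. [folklore] -/
theorem relabel_preimage_cellN (σ : Equiv.Perm (Fin N)) (L : ℝ) :
    (fun X : Config N => X ∘ σ) ⁻¹' cellN N L = cellN N L := by
  ext X
  exact ⟨fun h i => by simpa using h (σ.symm i), fun h i => h (σ i)⟩

/-- **Relabelling preserves Lebesgue measure on the cell.** [folklore] -/
theorem measurePreserving_relabel_restrict_cellN (σ : Equiv.Perm (Fin N)) (L : ℝ) :
    MeasurePreserving (fun X : Config N => X ∘ σ) (volume.restrict (cellN N L))
      (volume.restrict (cellN N L)) := by
  have h := (measurePreserving_relabel σ).restrict_preimage (measurableSet_cellN N L)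
  rwa [relabel_preimage_cellN] at h

/-- **The reduction to the cell commutes with relabelling**: `cellProj L (Y ∘ σ) = cellProj L Y ∘ σ`
(the reduction acts particle by particle). [folklore] -/
theorem cellProj_comp_perm (L : ℝ) (Y : Config N) (σ : Equiv.Perm (Fin N)) :
    cellProj L (Y ∘ σ) = cellProj L Y ∘ σ := by
  funext i
  simp only [cellProj, Pi.sub_apply, Function.comp_apply, latticeVecN]
  rfl

/-! ### The periodic positive representative `e⁺` -/

section PosRep

variable {e : Lp ℝ 2 (volume.restrict (cellN N L))}

/-- `e⁺ = max(e ∘ cellProj L, 0)` is measurable. [folklore] -/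
theorem measurable_pep (e : Lp ℝ 2 (volume.restrict (cellN N L))) :
    Measurable fun Y => max ((e : Config N → ℝ) (cellProj L Y)) 0 :=
  ((measurable_coeFn_Lp_cellN e).comp (measurable_cellProj L)).max measurable_const

/-- `e⁺` is periodic in every generator. [folklore] -/
theorem pep_periodic (hL : L ≠ 0) (e : Lp ℝ 2 (volume.restrict (cellN N L))) (Y : Config N)
    (i : Fin N) (k : Fin 3) :
    max ((e : Config N → ℝ) (cellProj L (Y + Pi.single i (EuclideanSpace.single k L)))) 0 =
      max ((e : Config N → ℝ) (cellProj L Y)) 0 := by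
  rw [cellProj_add_single hL]

/-- **`e⁺ = e ∘ cellProj L` a.e. on `(ℝ³)^N`** for `e ≥ 0`. [folklore] -/
theorem pep_ae_eq (hL : 0 < L) (he0 : 0 ≤ e) :
    (fun Y => max ((e : Config N → ℝ) (cellProj L Y)) 0) =ᵐ[(volume : Measure (Config N))]
      (e : Config N → ℝ) ∘ cellProj L := by
  have h : (fun Y => max ((e : Config N → ℝ) Y) 0) =ᵐ[volume.restrict (cellN N L)] (e : Config N → ℝ) := by
    filter_upwards [(Lp.coeFn_nonneg e).2 he0] with Y hY
    exact max_eq_left hY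
  exact ae_comp_cellProj hL h

/-- **`e⁺ = e` a.e. on the cell** for `e ≥ 0`. [folklore] -/
theorem pep_ae_eq_cell (hL : 0 < L) (he0 : 0 ≤ e) :
    (fun Y => max ((e : Config N → ℝ) (cellProj L Y)) 0) =ᵐ[volume.restrict (cellN N L)]
      (e : Config N → ℝ) := by
  filter_upwards [(Lp.coeFn_nonneg e).2 he0, ae_restrict_mem (measurableSet_cellN N L)] with Y hY hYc
  rw [cellProj_of_mem_cellN hL hYc]
  exact max_eq_left hY

/-- `e⁺` has the squared cell mass of `e` (finite). [folklore] -/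
theorem setLIntegral_pep_sq_ne_top (hL : 0 < L) (he0 : 0 ≤ e) :
    ∫⁻ Y in cellN N L, ‖max ((e : Config N → ℝ) (cellProj L Y)) 0‖ₑ ^ (2 : ℝ) ≠ ⊤ := by
  have h : (fun Y => ‖max ((e : Config N → ℝ) (cellProj L Y)) 0‖ₑ ^ (2 : ℝ)) =ᵐ[volume.restrict (cellN N L)]
      fun Y => ‖(e : Config N → ℝ) Y‖ₑ ^ (2 : ℝ) := by
    filter_upwards [pep_ae_eq_cell hL he0] with Y hY
    rw [hY]
  rw [lintegral_congr_ae h]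
  exact setLIntegral_cellN_enorm_sq_ne_top e

/-! ### The `L²` eigen-relation read on functions -/

/-- **`T_t e = μ₀ᵗ e` for every `t > 0`** (abstract: `semigroup_apply_eigenvector` and
`coeff_eq_rpow` for the symmetric positive contraction semigroup `pfkL2 v L ·`). [folklore] -/
theorem pfkL2_apply_eigen_rpow (hv : Measurable v) (hL : 0 < L) (hC : ∀ x, periodizedPotential v L x ≤ C)
    (he1 : ‖e‖ = 1) (hTe : pfkL2 v L 1 e = ‖pfkL2 (N := N) v L 1‖ • e)
    (hsimple : ∀ f, pfkL2 v L 1 f = ‖pfkL2 (N := N) v L 1‖ • f → ∃ c : ℝ, f = c • e)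
    {t : ℝ} (ht : 0 < t) : pfkL2 v L t e = ‖pfkL2 (N := N) v L 1‖ ^ t • e := by
  have hadd : ∀ s t : ℝ, 0 < s → 0 < t →
      pfkL2 (N := N) v L (s + t) = (pfkL2 v L s).comp (pfkL2 v L t) :=
    fun s t hs ht => pfkL2_add_time hv hL hs ht
  have hcontr : ∀ t : ℝ, 0 < t → ‖pfkL2 (N := N) v L t‖ ≤ 1 := fun t _ => norm_pfkL2_le_one v L t
  have hpos : ∀ t : ℝ, 0 < t → ∀ x : Lp ℝ 2 (volume.restrict (cellN N L)),
      0 ≤ ⟪pfkL2 v L t x, x⟫_ℝ := fun t ht x => inner_pfkL2_self_nonneg hv hL ht x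
  have hμ₀ : 0 < ‖pfkL2 (N := N) v L 1‖ :=
    norm_pos_iff.2 (pfkL2_perronFrobenius (N := N) hv hL hC one_pos).1
  rw [semigroup_apply_eigenvector (S := fun t => pfkL2 (N := N) v L t) hadd he1 hTe hsimple ht,
    coeff_eq_rpow (S := fun t => pfkL2 (N := N) v L t) hadd hcontr hpos he1 hTe hsimple hμ₀ ht]

/-- **`e^{-tH} e⁺ = μ₀ᵗ e` a.e. on the cell** (`t > 0`): the `L²` eigen-relation read through the
periodic extension. [folklore] -/
theorem pfkReal_pep_ae_eq_rpow (hv : Measurable v) (hL : 0 < L) (hC : ∀ x, periodizedPotential v L x ≤ C)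
    (he1 : ‖e‖ = 1) (he0 : 0 ≤ e) (hTe : pfkL2 v L 1 e = ‖pfkL2 (N := N) v L 1‖ • e)
    (hsimple : ∀ f, pfkL2 v L 1 f = ‖pfkL2 (N := N) v L 1‖ • f → ∃ c : ℝ, f = c • e)
    {t : ℝ} (ht : 0 < t) :
    pfkReal v L t (fun Y => max ((e : Config N → ℝ) (cellProj L Y)) 0) =ᵐ[volume.restrict (cellN N L)]
      fun Y => ‖pfkL2 (N := N) v L 1‖ ^ t * (e : Config N → ℝ) Y := by
  have h1 : ((pfkL2 v L t e : Lp ℝ 2 (volume.restrict (cellN N L))) : Config N → ℝ)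
      =ᵐ[volume.restrict (cellN N L)] pfkReal v L t (⇑e ∘ cellProj L) := pfkL2_coeFn hv hL ht e
  rw [pfkL2_apply_eigen_rpow hv hL hC he1 hTe hsimple ht] at h1
  have h2 : ∀ Y, pfkReal v L t (fun Z => max ((e : Config N → ℝ) (cellProj L Z)) 0) Y =
      pfkReal v L t (⇑e ∘ cellProj L) Y := fun Y => pfkReal_congr_ae v L ht (pep_ae_eq hL he0) Y
  filter_upwards [h1, Lp.coeFn_smul (‖pfkL2 (N := N) v L 1‖ ^ t) e] with Y hY1 hY2
  rw [h2 Y, ← hY1, hY2, Pi.smul_apply, smul_eq_mul]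

/-- **`e^{-tH} e⁺ = μ₀ᵗ e⁺` a.e. on `(ℝ³)^N`** (`t > 0`; both sides are periodic). [folklore] -/
theorem pfkReal_pep_ae_eq_rpow_pep (hv : Measurable v) (hL : 0 < L) (hC : ∀ x, periodizedPotential v L x ≤ C)
    (he1 : ‖e‖ = 1) (he0 : 0 ≤ e) (hTe : pfkL2 v L 1 e = ‖pfkL2 (N := N) v L 1‖ • e)
    (hsimple : ∀ f, pfkL2 v L 1 f = ‖pfkL2 (N := N) v L 1‖ • f → ∃ c : ℝ, f = c • e)
    {t : ℝ} (ht : 0 < t) :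
    pfkReal v L t (fun Y => max ((e : Config N → ℝ) (cellProj L Y)) 0) =ᵐ[(volume : Measure (Config N))]
      fun Y => ‖pfkL2 (N := N) v L 1‖ ^ t * max ((e : Config N → ℝ) (cellProj L Y)) 0 := by
  refine ae_eq_of_periodic_of_ae_eq_cellN hL
    (pfkReal_add_single_of_periodic v L t (f := fun Y => max ((e : Config N → ℝ) (cellProj L Y)) 0)
      (pep_periodic hL.ne' e))
    (fun Y i k => by simp only [pep_periodic hL.ne' e]) ?_
  filter_upwards [pfkReal_pep_ae_eq_rpow hv hL hC he1 he0 hTe hsimple ht, pep_ae_eq_cell hL he0]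
    with Y hY1 hY2
  rw [hY1, hY2]

end PosRep

/-! ### The witness `φ₀ = μ₀⁻¹ e^{-H} e⁺` -/

section Witness

variable {e : Lp ℝ 2 (volume.restrict (cellN N L))} {φ : Config N → ℝ}

/-- `φ₀ ≥ 0` (for `μ₀ ≥ 0`). [folklore] -/
theorem tgs_nonneg {μ₀ : ℝ} (hμ₀ : 0 ≤ μ₀)
    (hφ : φ = fun X => μ₀⁻¹ * pfkReal v L 1 (fun Y => max ((e : Config N → ℝ) (cellProj L Y)) 0) X)
    (X : Config N) : 0 ≤ φ X := by
  rw [hφ]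
  exact mul_nonneg (inv_nonneg.2 hμ₀) (pfkReal_nonneg v L 1 (fun Y => le_max_right _ _) X)

/-- `φ₀` is periodic in every generator. [folklore] -/
theorem tgs_periodic (hL : L ≠ 0) {μ₀ : ℝ}
    (hφ : φ = fun X => μ₀⁻¹ * pfkReal v L 1 (fun Y => max ((e : Config N → ℝ) (cellProj L Y)) 0) X)
    (X : Config N) (i : Fin N) (k : Fin 3) :
    φ (X + Pi.single i (EuclideanSpace.single k L)) = φ X := by
  rw [hφ]
  simp only [pfkReal_add_single_of_periodic v L 1
    (f := fun Y => max ((e : Config N → ℝ) (cellProj L Y)) 0) (pep_periodic hL e)]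

/-- **`φ₀` is continuous** (strong Feller property of `e^{-H}` on periodic `L²(cell)` data).
[folklore] -/
theorem continuous_tgs (hv : Measurable v) (hL : 0 < L) (hC : ∀ x, periodizedPotential v L x ≤ C)
    (he0 : 0 ≤ e) {μ₀ : ℝ}
    (hφ : φ = fun X => μ₀⁻¹ * pfkReal v L 1 (fun Y => max ((e : Config N → ℝ) (cellProj L Y)) 0) X) :
    Continuous φ := by
  rw [hφ]
  exact continuous_const.mul (continuous_pfkReal hv hL hC one_pos (measurable_pep e)
    (pep_periodic hL.ne' e) (setLIntegral_pep_sq_ne_top hL he0))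

/-- **`φ₀ = e` a.e. on the cell.** [folklore] -/
theorem tgs_ae_eq_cell (hv : Measurable v) (hL : 0 < L) (hC : ∀ x, periodizedPotential v L x ≤ C)
    (he1 : ‖e‖ = 1) (he0 : 0 ≤ e) (hTe : pfkL2 v L 1 e = ‖pfkL2 (N := N) v L 1‖ • e)
    (hsimple : ∀ f, pfkL2 v L 1 f = ‖pfkL2 (N := N) v L 1‖ • f → ∃ c : ℝ, f = c • e)
    (hφ : φ = fun X => ‖pfkL2 (N := N) v L 1‖⁻¹ *
      pfkReal v L 1 (fun Y => max ((e : Config N → ℝ) (cellProj L Y)) 0) X) :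
    φ =ᵐ[volume.restrict (cellN N L)] (e : Config N → ℝ) := by
  have hμ₀ : 0 < ‖pfkL2 (N := N) v L 1‖ :=
    norm_pos_iff.2 (pfkL2_perronFrobenius (N := N) hv hL hC one_pos).1
  filter_upwards [pfkReal_pep_ae_eq_rpow hv hL hC he1 he0 hTe hsimple one_pos] with Y hY
  rw [hφ]
  simp only [hY, Real.rpow_one]
  field_simp

/-- **The pointwise eigen-relation `e^{-TH} φ₀ = μ₀ᵀ φ₀`** for every `T > 0`, at EVERY point:
`e^{-TH}φ₀ = μ₀⁻¹ e^{-H}(e^{-TH} e⁺) = μ₀⁻¹ e^{-H}(μ₀ᵀ e⁺)` (semigroup law twice and insensitivity of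
`e^{-H}` to null modifications). [folklore] -/
theorem pfkReal_tgs (hv : Measurable v) (hL : 0 < L) (hC : ∀ x, periodizedPotential v L x ≤ C)
    (he1 : ‖e‖ = 1) (he0 : 0 ≤ e) (hTe : pfkL2 v L 1 e = ‖pfkL2 (N := N) v L 1‖ • e)
    (hsimple : ∀ f, pfkL2 v L 1 f = ‖pfkL2 (N := N) v L 1‖ • f → ∃ c : ℝ, f = c • e)
    (hφ : φ = fun X => ‖pfkL2 (N := N) v L 1‖⁻¹ *
      pfkReal v L 1 (fun Y => max ((e : Config N → ℝ) (cellProj L Y)) 0) X)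
    {T : ℝ} (hT : 0 < T) (X : Config N) :
    pfkReal v L T φ X = ‖pfkL2 (N := N) v L 1‖ ^ T * φ X := by
  set μ₀ : ℝ := ‖pfkL2 (N := N) v L 1‖ with hμ₀def
  set ep : Config N → ℝ := fun Y => max ((e : Config N → ℝ) (cellProj L Y)) 0 with hep
  have hepm : Measurable ep := measurable_pep e
  have hepper := pep_periodic (N := N) hL.ne' e
  have hep2 := setLIntegral_pep_sq_ne_top (N := N) hL he0
  -- `e^{-TH} φ₀ = μ₀⁻¹ e^{-(T+1)H} e⁺`
  have h1 : pfkReal v L T φ X = μ₀⁻¹ * pfkReal v L (T + 1) ep X := by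
    rw [hφ, pfkReal_const_mul, ← pfkReal_add_time hv hL hT one_pos hepm hepper hep2 X]
  -- `e^{-(1+T)H} e⁺ = e^{-H}(μ₀ᵀ e⁺)`
  have h2 : pfkReal v L (T + 1) ep X = μ₀ ^ T * pfkReal v L 1 ep X := by
    rw [add_comm, pfkReal_add_time hv hL one_pos hT hepm hepper hep2 X,
      pfkReal_congr_ae v L one_pos (pfkReal_pep_ae_eq_rpow_pep hv hL hC he1 he0 hTe hsimple hT) X,
      pfkReal_const_mul]
  rw [h1, h2, hφ]
  ring

/-- **`φ₀ > 0` EVERYWHERE** (positivity improving of `e^{-H}` at every point; `e⁺` is not a.e. zero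
on the cell since `‖e‖ = 1`). [folklore] -/
theorem tgs_pos (hv : Measurable v) (hL : 0 < L) (hC : ∀ x, periodizedPotential v L x ≤ C)
    (he1 : ‖e‖ = 1) (he0 : 0 ≤ e)
    (hφ : φ = fun X => ‖pfkL2 (N := N) v L 1‖⁻¹ *
      pfkReal v L 1 (fun Y => max ((e : Config N → ℝ) (cellProj L Y)) 0) X)
    (X : Config N) : 0 < φ X := by
  have hμ₀ : 0 < ‖pfkL2 (N := N) v L 1‖ :=
    norm_pos_iff.2 (pfkL2_perronFrobenius (N := N) hv hL hC one_pos).1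
  have hne : ¬ (fun Y => max ((e : Config N → ℝ) (cellProj L Y)) 0) =ᵐ[volume.restrict (cellN N L)] 0 := by
    intro h
    have h1 : (e : Config N → ℝ) =ᵐ[volume.restrict (cellN N L)] 0 := (pep_ae_eq_cell hL he0).symm.trans h
    have := Lp.eq_zero_iff_ae_eq_zero.2 h1
    rw [this, norm_zero] at he1
    exact zero_ne_one he1
  rw [hφ]
  exact mul_pos (inv_pos.2 hμ₀) (pfkReal_pos_of_nonneg hv hL hC one_pos (measurable_pep e)
    (fun Y => le_max_right _ _) (pep_periodic hL.ne' e) (setLIntegral_pep_sq_ne_top hL he0) hne X)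

end Witness

end Summit.AtomisticToContinuum.BoseEinsteinCondensation.Theorems.PositiveMinimiser

end
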